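import Mathlib
import Summits.NavierStokesRegularity.NavierStokesRegularity.Theorems.EulerZoomLiouvillePowerGaugeEulerLiouvilleBandClock
import Summits.NavierStokesRegularity.NavierStokesRegularity.Theorems.EulerZoomLiouvillePowerGaugeEulerLiouvilleNeedleWaitingTimeMember
import Summits.NavierStokesRegularity.NavierStokesRegularity.Theorems.EulerZoomLiouvillePowerGaugeEulerLiouvilleNeedleClockPast
import Summits.NavierStokesRegularity.NavierStokesRegularity.Theorems.EulerZoomLiouvillePowerGaugeEulerLiouvilleCondenserMinimalType
import Summits.NavierStokesRegularity.NavierStokesRegularity.Theorems.EulerZoomLiouvillePowerGaugeEulerLiouvilleSelfSimilarPastStrata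
import HarnessLib

/-!
# «ONLY NEAR-CIRCULAR ORBITS SURVIVE», II (members): an inflow half-band deficit of the radial acceleration kills — centred and past-exact
# (crux `EulerZoomLiouville.PowerGaugeEulerLiouville` = stmt-NavierStokesRegularity-19832, THE ONE STATEMENT `stub_selfSimilarC2Needle`; binder `HasFastVorticalChannel` alt 2)

Route `EulerZoomLiouville` (NavierStokesRegularity), crux E, LEAD seat ns-typeII-p2 g13 (own brick).  By-name assembly of the class-free clock
`BandClock.logClock_of_bandDeficit` (this seat, `…BandClock`) with the log-clock thresholds `NeedleRace.selfSimilar_ae_eq_zero_of_logClockC2` (ns-ezl-w2 g3) /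
`…_past` (ns-ezl-w4 g4) over a classical pressure of the profile (`WeakToClassical.exists_isSelfSimilarEulerProfile_of_contDiff` / `Past.exists_isSelfSimilarEulerProfile`).
With `W y = γy + V y`, `γ = 1/(2+ρ)`, `ℛ(y) = ⟪y, W y⟫`, `a(y) = ‖W y‖² + γ⟪y, W y⟫ + ⟪y, DV(y)(W y)⟫` (forward radial acceleration):

* **`Loc.selfSimilar_ae_eq_zero_of_inflowBandDeficitC2_profile`** — crux hypotheses (`0 < ρ ≤ ½`), exact self-similarity about the origin with a `C²` profile `V`,
  and, for ONE pair `c₁ > 0`, `μ > 0`, every classical pressure `P′` and every level `h`, a radius beyond which every VORTICAL point of `{ℋ_{P′} > h}` in the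
  INFLOW HALF-BAND `−c₁‖y‖² ≤ ℛ(y) ≤ 0` has `a(y) ≥ (2c₁² + μ)‖y‖²` ⇒ `u = 0` a.e. on the slab.  CONTAINS «any fast channel kills»
  (`Loc.selfSimilar_ae_eq_zero_of_vorticalChannelC2_profile_anyRate`: a channel at rate `2c₁` empties the half-band).
* **`Past.selfSimilar_ae_eq_zero_of_inflowBandDeficitC2_profile_past`** — the same for members exactly self-similar about `(T, x₀)` for `τ < T₁` only.

For the skeleton (LEAD, v84): `HasFastVorticalChannel ρ V` gains alternative 2 (the deficit text above, `∀ P′` form); fillers: these two theorems.  THE ONE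
STATEMENT's residue: for all `c₁, μ > 0` the needle has, beyond every radius, vortical Bernoulli-high NEAR-CIRCULAR INFLOW points with sub-threshold radial
acceleration — by (3.3) `a = 2ℋ + 2γ(1−γ)‖y‖² − (1−2γ)ℛ − (2P′ + y·∇P′)`, these are VIRIAL-SUPPORTED: `2P′ + y·∇P′ > 2h + (2γ(1−γ) − 2c₁² − μ)‖y‖²`.
WHAT THIS IS NOT: not NS, not E — strata on the model lattice; DENT 0 on the registered stubs; 19832 OPEN; NS regularity is NOT proved.
[folklore; ConstantinIgnatovaVicol2026Putative §3.4–§3.5]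
-/

noncomputable section

-- flat `Theorems/<Route><Decl>…` files of one crux share the namespace of the crux (tree convention: `Summit.<S>.<S>.…`)
set_option linter.dupNamespace false

open Set Filter Topology Metric Function MeasureTheory
open scoped RealInnerProductSpace NNReal ENNReal

namespace Summit.NavierStokesRegularity.NavierStokesRegularity.Theorems.PowerGaugeEulerLiouville

open Literature.Analysis Literature.Analysis.FluidPDE

/-- **EXACTLY SELF-SIMILAR MEMBERS WHOSE `C²` PROFILE HAS AN INFLOW HALF-BAND DEFICIT OF THE RADIAL ACCELERATION ARE TRIVIAL** (see the module docstring;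
crux hypotheses verbatim, `0 < ρ ≤ ½`, exact self-similarity about the origin, `V ∈ C²`).  Proof = classical pressure ⇒ `BandClock.logClock_of_bandDeficit` ⇒
`NeedleRace.selfSimilar_ae_eq_zero_of_logClockC2`. [folklore; ConstantinIgnatovaVicol2026Putative §3.4–§3.5] -/
theorem Loc.selfSimilar_ae_eq_zero_of_inflowBandDeficitC2_profile {ρ : ℝ} (hρ : 0 < ρ) (hρ1 : ρ ≤ 1 / 2)
    {u : ℝ → EuclideanSpace ℝ (Fin 3) → EuclideanSpace ℝ (Fin 3)} {p : ℝ → EuclideanSpace ℝ (Fin 3) → ℝ}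
    {H : ℝ → EuclideanSpace ℝ (Fin 3) → EuclideanSpace ℝ (Fin 3) →L[ℝ] EuclideanSpace ℝ (Fin 3)} {c : ℝ≥0}
    (hsw : IsSuitableWeakSolutionOn (slab (EuclideanSpace ℝ (Fin 3)) (Iio 0) isOpen_Iio) 0 0 u p)
    (hH : HasWeakSpatialGradientOn (slab (EuclideanSpace ℝ (Fin 3)) (Iio 0) isOpen_Iio) u H)
    (hgauge : ∀ a : ℝ, 0 < a →
      ENNReal.ofReal (a ^ (2 * ρ)) * cknA a (0 : ℝ × EuclideanSpace ℝ (Fin 3)) u +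
          ENNReal.ofReal (a ^ ρ) * cknE a (0 : ℝ × EuclideanSpace ℝ (Fin 3)) H +
        ENNReal.ofReal (a ^ (2 * ρ)) * cknD a (0 : ℝ × EuclideanSpace ℝ (Fin 3)) p ≤ (c : ℝ≥0∞))
    {V : EuclideanSpace ℝ (Fin 3) → EuclideanSpace ℝ (Fin 3)} {P : EuclideanSpace ℝ (Fin 3) → ℝ}
    (hu : ∀ τ : ℝ, τ < 0 → u τ = selfSimilarCollapse (1 / (2 + ρ)) 0 V τ)
    (hp : ∀ τ : ℝ, τ < 0 → p τ = selfSimilarCollapsePressure (1 / (2 + ρ)) 0 P τ)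
    (hV : ContDiff ℝ 2 V) {c₁ μ : ℝ} (hc₁ : 0 < c₁) (hμ : 0 < μ)
    (hB : ∀ P' : EuclideanSpace ℝ (Fin 3) → ℝ, IsSelfSimilarEulerProfile (1 / (2 + ρ)) 0 V P' →
      ∀ h : ℝ, ∃ R₀ : ℝ, ∀ y : EuclideanSpace ℝ (Fin 3), R₀ ≤ ‖y‖ →
        h < selfSimilarBernoulli (1 / (2 + ρ)) 0 V P' y → curl V y ≠ 0 →
          -(c₁ * ‖y‖ ^ 2) ≤ ⟪y, selfSimilarTransport (1 / (2 + ρ)) 0 V y⟫ →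
          ⟪y, selfSimilarTransport (1 / (2 + ρ)) 0 V y⟫ ≤ 0 →
          (2 * c₁ ^ 2 + μ) * ‖y‖ ^ 2 ≤ ‖selfSimilarTransport (1 / (2 + ρ)) 0 V y‖ ^ 2 +
            (1 / (2 + ρ)) * ⟪y, selfSimilarTransport (1 / (2 + ρ)) 0 V y⟫ +
            ⟪y, fderiv ℝ V y (selfSimilarTransport (1 / (2 + ρ)) 0 V y)⟫) :
    uncurry u =ᵐ[volume.restrict (Iio (0 : ℝ) ×ˢ (univ : Set (EuclideanSpace ℝ (Fin 3))))] 0 := by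
  have hρ1' : ρ < 1 := by linarith
  -- ### a classical pressure for the profile
  have hD : ∀ a : ℝ, 0 < a → ENNReal.ofReal (a ^ (2 * ρ)) *
      cknD a (0 : ℝ × EuclideanSpace ℝ (Fin 3)) p ≤ (c : ℝ≥0∞) :=
    fun a ha => le_trans le_add_self (hgauge a ha)
  have hpm : AEStronglyMeasurable (uncurry p)
      (volume.restrict (Iio (0 : ℝ) ×ˢ (univ : Set (EuclideanSpace ℝ (Fin 3))))) := by
    have := hsw.distributional.2.2.1.aestronglyMeasurable
    simpa [slab] using this
  have hPm := aestronglyMeasurable_pressureProfile hpm hp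
  have hDprof := profile_pressure_weight_of_gaugeD hρ hρ1' hpm hp hD
  have hP1 : LocallyIntegrable P volume :=
    EnergySaturation.locallyIntegrable_pressure_of_weight hρ1' hPm
      (ENNReal.mul_ne_top ENNReal.ofReal_ne_top ENNReal.coe_ne_top) hDprof
  obtain ⟨P', hprof⟩ :=
    WeakToClassical.exists_isSelfSimilarEulerProfile_of_contDiff hsw.distributional hu hp hV hP1
  -- ### the deficit is a log residence clock with `s₁ = 1/c₁ + 2`
  have hclock := BandClock.logClock_of_bandDeficit hρ hρ1 hprof hc₁ hμ (hB P' hprof)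
  have hs₁ : (0 : ℝ) ≤ 1 / c₁ + 2 := by positivity
  -- ### every log clock kills
  exact NeedleRace.selfSimilar_ae_eq_zero_of_logClockC2 hρ hρ1 hsw hH hgauge hu hp hV hs₁ hclock

namespace Past

variable {ρ T T₁ : ℝ}
  {u : ℝ → EuclideanSpace ℝ (Fin 3) → EuclideanSpace ℝ (Fin 3)} {p : ℝ → EuclideanSpace ℝ (Fin 3) → ℝ}
  {H : ℝ → EuclideanSpace ℝ (Fin 3) → EuclideanSpace ℝ (Fin 3) →L[ℝ] EuclideanSpace ℝ (Fin 3)} {c : ℝ≥0}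
  {V : EuclideanSpace ℝ (Fin 3) → EuclideanSpace ℝ (Fin 3)} {P : EuclideanSpace ℝ (Fin 3) → ℝ}

/-- **PAST-EXACT MEMBER WHOSE `C²` PROFILE HAS AN INFLOW HALF-BAND DEFICIT OF THE RADIAL ACCELERATION IS TRIVIAL** (crux hypotheses verbatim, `0 < ρ ≤ ½`;
exact self-similarity about `(T, x₀)` for `τ < T₁`, `T₁ ≤ 0`, `T₁ ≤ T`; `V ∈ C²`).  Proof = `Past.exists_isSelfSimilarEulerProfile` ⇒ `BandClock.logClock_of_bandDeficit`
⇒ `NeedleRace.selfSimilar_ae_eq_zero_of_logClockC2_past`. [folklore; ConstantinIgnatovaVicol2026Putative §3.4–§3.5] -/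
theorem selfSimilar_ae_eq_zero_of_inflowBandDeficitC2_profile_past (hρ : 0 < ρ) (hρh : ρ ≤ 1 / 2) (hT₁ : T₁ ≤ 0)
    (hTT₁ : T₁ ≤ T) (x₀ : EuclideanSpace ℝ (Fin 3))
    (hsw : IsSuitableWeakSolutionOn (slab (EuclideanSpace ℝ (Fin 3)) (Iio 0) isOpen_Iio) 0 0 u p)
    (hH : HasWeakSpatialGradientOn (slab (EuclideanSpace ℝ (Fin 3)) (Iio 0) isOpen_Iio) u H)
    (hgauge : ∀ a : ℝ, 0 < a →
      ENNReal.ofReal (a ^ (2 * ρ)) * cknA a (0 : ℝ × EuclideanSpace ℝ (Fin 3)) u +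
          ENNReal.ofReal (a ^ ρ) * cknE a (0 : ℝ × EuclideanSpace ℝ (Fin 3)) H +
        ENNReal.ofReal (a ^ (2 * ρ)) * cknD a (0 : ℝ × EuclideanSpace ℝ (Fin 3)) p ≤ (c : ℝ≥0∞))
    (hu : ∀ τ : ℝ, τ < T₁ → u τ = fun x => selfSimilarCollapse (1 / (2 + ρ)) T V τ (x - x₀))
    (hp : ∀ τ : ℝ, τ < T₁ → p τ = fun x => selfSimilarCollapsePressure (1 / (2 + ρ)) T P τ (x - x₀))
    (hV : ContDiff ℝ 2 V) {c₁ μ : ℝ} (hc₁ : 0 < c₁) (hμ : 0 < μ)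
    (hB : ∀ P' : EuclideanSpace ℝ (Fin 3) → ℝ, IsSelfSimilarEulerProfile (1 / (2 + ρ)) 0 V P' →
      ∀ h : ℝ, ∃ R₀ : ℝ, ∀ y : EuclideanSpace ℝ (Fin 3), R₀ ≤ ‖y‖ →
        h < selfSimilarBernoulli (1 / (2 + ρ)) 0 V P' y → curl V y ≠ 0 →
          -(c₁ * ‖y‖ ^ 2) ≤ ⟪y, selfSimilarTransport (1 / (2 + ρ)) 0 V y⟫ →
          ⟪y, selfSimilarTransport (1 / (2 + ρ)) 0 V y⟫ ≤ 0 →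
          (2 * c₁ ^ 2 + μ) * ‖y‖ ^ 2 ≤ ‖selfSimilarTransport (1 / (2 + ρ)) 0 V y‖ ^ 2 +
            (1 / (2 + ρ)) * ⟪y, selfSimilarTransport (1 / (2 + ρ)) 0 V y⟫ +
            ⟪y, fderiv ℝ V y (selfSimilarTransport (1 / (2 + ρ)) 0 V y)⟫) :
    uncurry u =ᵐ[volume.restrict (Iio (0 : ℝ) ×ˢ (univ : Set (EuclideanSpace ℝ (Fin 3))))] 0 := by
  -- ### a classical pressure for the profile (far-past extension)
  obtain ⟨P', hprof⟩ := exists_isSelfSimilarEulerProfile hρ hT₁ hTT₁ hsw.distributional hu hp hV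
  -- ### the deficit is a log residence clock with `s₁ = 1/c₁ + 2`
  have hclock := BandClock.logClock_of_bandDeficit hρ hρh hprof hc₁ hμ (hB P' hprof)
  have hs₁ : (0 : ℝ) ≤ 1 / c₁ + 2 := by positivity
  -- ### every log clock kills (past twin)
  exact NeedleRace.selfSimilar_ae_eq_zero_of_logClockC2_past hρ hρh hT₁ hTT₁ x₀ hsw hH hgauge hu hp hV hs₁ hclock

end Past

end Summit.NavierStokesRegularity.NavierStokesRegularity.Theorems.PowerGaugeEulerLiouville

end
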